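import Summits.QuantumAdvantage.QuantumAdvantage.Theorems.ExactPairsMaioranaMcFarland.Negative.H104Pair

/-!
# Mutation analysis of line `two-adic-local-nongeneric` (crux `CubicForrelation.ExactPairsMaioranaMcFarland`, stmt-QuantumAdvantage-2205)

Negative-side support file (drefute seat `refuter-drefute-stmt-QuantumAdvantage-2205-0`, 2026-08-16).  The picked line
(`Cruxes/ExactPairsMaioranaMcFarland/Lines/two-adic-local-nongeneric.lean`) has five stubs; none is refuted AS FILED
(stubs 1, 2, 5 are theorems in print, stubs 3–4 are implied by the crux).  This file proves, kernel-checked, which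
hypotheses of the LOAD-BEARING stub `stub_local_to_global` and of `stub_two_adic_flats` cannot be dropped, with the
Polujan–Pott pair of `Negative/H104Pair.lean` (`g4 = h^10_4`, cubic bent, NOT in MM#; `f4` = its quartic dual) as
the witness in both directions:

* `localToGlobal_false_without_flats` : stub 3 with the 2-adic flat hypothesis dropped is FALSE (m = 5, g = g4,
  f = f4): `g4` is cubic and bent but has no 5-dimensional T-singular subspace (rind g4 = 4; certificate
  `bigCountConstC_g = 10 < 32`).
* `localToGlobal_false_without_gCubic_dualForm` : stub 3 with "g cubic" dropped and the flat hypothesis replaced by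
  its intended meaning "the dual f is cubic" is FALSE (m = 5, g = f4, f = g4): NO two distinct non-zero directions
  `a, b` have `D_aD_b f4` constant (certificate `bigCountConstC_f = 1`).
* `localToGlobal_false_without_gCubic_of_twoAdicFlats` : the LITERAL drop of "g cubic" from stub 3 is false as soon
  as stub 2 (`TwoAdicFlats`, restated verbatim) holds — same witness.
* `twoAdicFlats_false_without_fCubic` : stub 2 with "f cubic" dropped is FALSE (m = 5, g = g4, f = f4, the
  coordinate 6-flat `{x : x₀ = x₁ = x₂ = x₃ = 0}`, shift 0: weight 22, not divisible by `4 = 2^{5-3}`).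
* `dillonNormalForm_false_without_bent` : stub 5 with bentness dropped is FALSE (m = 1, g = 0, V = {x : x₁ = 0}).

The certificate (`count_ge_of_singular` / `countConst_transfer` / `not_singular_of_bigCountConstC_lt`) is the
"constant second derivative" analogue of `Negative.DillonCertificate.count_ge_of_MM`: a T-singular 32-set `V` gives
32 directions `b` each with ≥ 32 sampled-constant partners `a`; the sample points `0, e₀, …, e₉` make the sampled test
EXACT for cubic functions (`D_aD_b g(x) + D_aD_b g(0) = T_g(a,b,x)` is linear in `x`) and a superset test in general.
Everything is sorry-free; `native_decide` is used for the finite certificates (`computational`).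

References: A. Polujan, A. Pott, Des. Codes Cryptogr. 88 (2020), arXiv:1908.11271 (h^10_4); J. F. Dillon, PhD thesis
(1974) (M-subspaces, relaxed M-subspaces); C. Carlet, Boolean Functions for Cryptography and Coding Theory (2021) §6.1.
-/

set_option linter.dupNamespace false

namespace Summit.QuantumAdvantage.QuantumAdvantage.Theorems.ExactPairsMaioranaMcFarland.Negative.TwoAdicMutations

open Literature.Computability.QuantumComplexity
open Literature.Computability.QuantumComplexity.BuzetChailloux (bxor)
open Summit.QuantumAdvantage.QuantumAdvantage.Theorems.ExactPairsMaioranaMcFarland.Negative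
open Summit.QuantumAdvantage.QuantumAdvantage.Theorems.ExactPairsMaioranaMcFarland.Negative.H104Pair

/-! ### The T-singular ("relaxed M-subspace") conclusion of `stub_local_to_global` and a counting certificate against it -/

/-- The conclusion of `stub_local_to_global` at a general `m` (verbatim shape): an xor-closed `V` with `|V| = 2^m` on
which every second derivative `D_aD_b g` (`a b ∈ V`) is CONSTANT. -/
def SingularConclusionAt (m : ℕ) (g : (Fin (m + m) → Bool) → Bool) : Prop :=
  ∃ V : Finset (Fin (m + m) → Bool), (∀ a ∈ V, ∀ b ∈ V, bxor a b ∈ V) ∧ V.card = 2 ^ m ∧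
    ∀ a ∈ V, ∀ b ∈ V, ∀ x y : Fin (m + m) → Bool,
      (g x ^^ g (bxor x a) ^^ g (bxor x b) ^^ g (bxor (bxor x a) b)) =
        (g y ^^ g (bxor y a) ^^ g (bxor y b) ^^ g (bxor (bxor y a) b))

/-- second derivative of a table function at a code point -/
def sdT (t : ℕ → Bool) (a b x : ℕ) : Bool := t x ^^ t (x ^^^ a) ^^ t (x ^^^ b) ^^ t (x ^^^ a ^^^ b)

/-- sampled constancy test: the second derivative takes the same value at all sample points as at `0` -/
def compatConstT (t : ℕ → Bool) (a b : ℕ) : Bool :=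
  S1.all fun x => sdT t a b x == sdT t a b 0

/-- second derivative of a function at a decoded point -/
def sdF (g : (Fin 10 → Bool) → Bool) (a b : Fin 10 → Bool) (k : ℕ) : Bool :=
  g (dec k) ^^ g (bxor (dec k) a) ^^ g (bxor (dec k) b) ^^ g (bxor (bxor (dec k) a) b)

/-- sampled constancy test on functions -/
def compatConstF (g : (Fin 10 → Bool) → Bool) (a b : Fin 10 → Bool) : Prop :=
  ∀ k ∈ S1, sdF g a b k = sdF g a b 0

/-- the sampled constancy test is decidable -/
instance (g : (Fin 10 → Bool) → Bool) (a b : Fin 10 → Bool) : Decidable (compatConstF g a b) := by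
  unfold compatConstF; infer_instance

/-- number of directions `b` (including `0`) admitting at least 32 sampled-constant `a` -/
def bigCountConstC (t : ℕ → Bool) : ℕ :=
  (Finset.univ.filter fun b : Fin 1024 =>
    32 ≤ (Finset.univ.filter fun a : Fin 1024 => compatConstT t a b = true).card).card

/-- certificate value for `g4 = h^10_4`: only 10 directions (incl. `0`) have ≥ 32 constant partners -/
theorem bigCountConstC_g : bigCountConstC gT = 10 := by native_decide

/-- certificate value for the quartic dual `f4`: only `b = 0` has ≥ 32 constant partners -/
theorem bigCountConstC_f : bigCountConstC fT = 1 := by native_decide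

/-- the two spellings of pointwise xor agree -/
theorem bx_eq_bxor {n : ℕ} (x a : Fin n → Bool) : bx x a = bxor x a := rfl

/-- A T-singular 32-element `V` forces at least 32 directions with at least 32 sampled-constant partners. -/
theorem count_ge_of_singular (g : (Fin (5 + 5) → Bool) → Bool) (hg : SingularConclusionAt 5 g) :
    32 ≤ (Finset.univ.filter fun b : Fin 10 → Bool =>
      32 ≤ (Finset.univ.filter fun a : Fin 10 → Bool => compatConstF g a b).card).card := by
  obtain ⟨V, -, hV, hD⟩ := hg
  have h1 : ∀ b ∈ V, V ⊆ Finset.univ.filter fun a => compatConstF g a b := by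
    intro b hb a ha
    simp only [Finset.mem_filter, Finset.mem_univ, true_and]
    intro k _
    exact hD a ha b hb (dec k) (dec 0)
  have h2 : V ⊆ Finset.univ.filter fun b : Fin 10 → Bool =>
      32 ≤ (Finset.univ.filter fun a : Fin 10 → Bool => compatConstF g a b).card := by
    intro b hb
    simp only [Finset.mem_filter, Finset.mem_univ, true_and]
    calc 32 = V.card := hV.symm
      _ ≤ _ := Finset.card_le_card (h1 b hb)
  calc 32 = V.card := hV.symm
    _ ≤ _ := Finset.card_le_card h2

/-- transfer of the sampled constancy test from functions to tables -/
theorem compatConst_transfer (g : (Fin 10 → Bool) → Bool) (t : ℕ → Bool)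
    (ht : ∀ k, k < 1024 → t k = g (dec k)) (a b : Fin 1024) :
    compatConstF g (E a) (E b) ↔ compatConstT t a b = true := by
  simp only [compatConstF, compatConstT, E_apply, List.all_eq_true, beq_iff_eq]
  have key : ∀ k, k < 1024 → sdF g (dec a) (dec b) k = sdT t a b k := by
    intro k hk
    have h1 : k ^^^ (a : ℕ) < 1024 := Nat.xor_lt_two_pow (n := 10) hk a.isLt
    have h2 : k ^^^ (b : ℕ) < 1024 := Nat.xor_lt_two_pow (n := 10) hk b.isLt
    have h3 : k ^^^ (a : ℕ) ^^^ (b : ℕ) < 1024 := Nat.xor_lt_two_pow (n := 10) h1 b.isLt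
    simp only [sdF, sdT, ht _ hk, ht _ h1, ht _ h2, ht _ h3, dec_xor, bx_eq_bxor]
  refine forall₂_congr fun k hk => ?_
  rw [key k (S1_lt k hk), key 0 (by norm_num)]

/-- transfer of the direction count from functions to tables -/
theorem countConst_transfer (g : (Fin 10 → Bool) → Bool) (t : ℕ → Bool)
    (ht : ∀ k, k < 1024 → t k = g (dec k)) :
    (Finset.univ.filter fun b : Fin 10 → Bool =>
      32 ≤ (Finset.univ.filter fun a : Fin 10 → Bool => compatConstF g a b).card).card = bigCountConstC t := by
  have inner : ∀ k : Fin 1024, (Finset.univ.filter fun a : Fin 10 → Bool => compatConstF g a (E k)).card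
      = (Finset.univ.filter fun a : Fin 1024 => compatConstT t a k = true).card := by
    intro k
    refine (card_filter_E _).trans ?_
    exact congrArg Finset.card (Finset.filter_congr fun a _ => compatConst_transfer g t ht a k)
  refine (card_filter_E _).trans ?_
  unfold bigCountConstC
  exact congrArg Finset.card (Finset.filter_congr fun k _ => by rw [inner])

/-- Counting certificate: fewer than 32 good directions ⇒ no 5-dimensional T-singular subspace. -/
theorem not_singular_of_bigCountConstC_lt (g : (Fin (5 + 5) → Bool) → Bool) (t : ℕ → Bool)
    (ht : ∀ k, k < 1024 → t k = g (dec k)) (hlt : bigCountConstC t < 32) : ¬ SingularConclusionAt 5 g := by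
  intro h
  have h32 := count_ge_of_singular g h
  rw [countConst_transfer g t ht] at h32
  omega

/-- rind `h^10_4` < 5: the cubic bent `g4` has no 5-dimensional T-singular subspace. -/
theorem g4_not_singular : ¬ SingularConclusionAt 5 g4 :=
  not_singular_of_bigCountConstC_lt g4 gT gT_eq (by rw [bigCountConstC_g]; norm_num)

/-- The quartic bent `f4` has no 5-dimensional subspace with constant second derivatives (indeed no two distinct
non-zero directions with `D_aD_b f4` constant). -/
theorem f4_not_singular : ¬ SingularConclusionAt 5 f4 :=
  not_singular_of_bigCountConstC_lt f4 fT fT_eq (by rw [bigCountConstC_f]; norm_num)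

/-! ### Mutations of `stub_local_to_global` -/

/-- `stub_local_to_global` with its 2-adic flat hypothesis DROPPED: "every cubic bent `g` (with dual `f`) has an
`m`-dimensional T-singular subspace". -/
def LocalToGlobalWithoutFlats : Prop :=
  ∀ (m : ℕ) (f g : (Fin (m + m) → Bool) → Bool),
    (∃ p : MvPolynomial (Fin (m + m)) (ZMod 2), p.totalDegree ≤ 3 ∧
      ∀ x, g x = decide (MvPolynomial.eval (fun j => if x j then (1 : ZMod 2) else 0) p = 1)) →
    (∀ b : Fin (m + m) → Bool, DerivativeWalsh.W (fun x => signOf (g x)) b = (2 : ℝ) ^ m * signOf (f b)) →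
    SingularConclusionAt m g

/-- Any proof of `stub_local_to_global` must use the 2-adic flat hypothesis (equivalently: that the dual is cubic):
PP20's `h^10_4` is cubic and bent (dual `f4`, quartic) with rind 4 < 5. -/
theorem localToGlobal_false_without_flats : ¬ LocalToGlobalWithoutFlats :=
  fun h => g4_not_singular (h 5 f4 g4 g4_cubic W_g4)

/-- `stub_local_to_global` with "g cubic" DROPPED and the flat hypothesis read as its intended equivalent "the dual `f`
is cubic": "every bent `g` with CUBIC dual has an `m`-dimensional subspace of constant second derivatives". -/
def LocalToGlobalWithoutGCubicDualForm : Prop :=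
  ∀ (m : ℕ) (f g : (Fin (m + m) → Bool) → Bool),
    (∃ p : MvPolynomial (Fin (m + m)) (ZMod 2), p.totalDegree ≤ 3 ∧
      ∀ x, f x = decide (MvPolynomial.eval (fun j => if x j then (1 : ZMod 2) else 0) p = 1)) →
    (∀ b : Fin (m + m) → Bool, DerivativeWalsh.W (fun x => signOf (g x)) b = (2 : ℝ) ^ m * signOf (f b)) →
    SingularConclusionAt m g

/-- Any proof of `stub_local_to_global` must use that `g` itself is cubic: the quartic bent `f4` has CUBIC dual `g4`
and not even two distinct non-zero directions with constant second derivative. -/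
theorem localToGlobal_false_without_gCubic_dualForm : ¬ LocalToGlobalWithoutGCubicDualForm :=
  fun h => f4_not_singular (h 5 g4 f4 g4_cubic W_f4)

/-- The 2-adic flat hypothesis of stubs 2–3 at a general `m` (verbatim shape): every codimension-4 flat of `g` has
weight divisible by `2^{m-3}`. -/
def FlatsAt (m : ℕ) (g : (Fin (m + m) → Bool) → Bool) : Prop :=
  ∀ E : Finset (Fin (m + m) → Bool), (∀ a ∈ E, ∀ b ∈ E, bxor a b ∈ E) → E.card = 2 ^ (m + m - 4) →
    ∀ a : Fin (m + m) → Bool, 2 ^ (m - 3) ∣ (E.filter fun x => g (bxor a x) = true).card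

/-- The statement of `stub_two_adic_flats` (verbatim shape): cubic dual ⇒ 2-adically quadratic codimension-4 flats. -/
def TwoAdicFlats : Prop :=
  ∀ (m : ℕ) (f g : (Fin (m + m) → Bool) → Bool),
    (∃ p : MvPolynomial (Fin (m + m)) (ZMod 2), p.totalDegree ≤ 3 ∧
      ∀ x, f x = decide (MvPolynomial.eval (fun j => if x j then (1 : ZMod 2) else 0) p = 1)) →
    (∀ b : Fin (m + m) → Bool, DerivativeWalsh.W (fun x => signOf (g x)) b = (2 : ℝ) ^ m * signOf (f b)) →
    FlatsAt m g

/-- `stub_local_to_global` with "g cubic" DROPPED, literally. -/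
def LocalToGlobalWithoutGCubic : Prop :=
  ∀ (m : ℕ) (f g : (Fin (m + m) → Bool) → Bool),
    (∀ b : Fin (m + m) → Bool, DerivativeWalsh.W (fun x => signOf (g x)) b = (2 : ℝ) ^ m * signOf (f b)) →
    FlatsAt m g → SingularConclusionAt m g

/-- Given the line's own stub 2, the literal drop of "g cubic" from `stub_local_to_global` is false (witness `f4`, whose
dual `g4` is cubic, so stub 2 grants it the flat hypothesis). -/
theorem localToGlobal_false_without_gCubic_of_twoAdicFlats : TwoAdicFlats → ¬ LocalToGlobalWithoutGCubic :=
  fun h2 h => f4_not_singular (h 5 g4 f4 W_f4 (h2 5 g4 f4 g4_cubic W_f4))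

/-! ### Mutation of `stub_two_adic_flats`: "f cubic" cannot be dropped -/

/-- `stub_two_adic_flats` with "f cubic" DROPPED: "every bent `g` has 2-adically quadratic codimension-4 flats". -/
def TwoAdicFlatsWithoutFCubic : Prop :=
  ∀ (m : ℕ) (f g : (Fin (m + m) → Bool) → Bool),
    (∀ b : Fin (m + m) → Bool, DerivativeWalsh.W (fun x => signOf (g x)) b = (2 : ℝ) ^ m * signOf (f b)) →
    FlatsAt m g

/-- the coordinate 6-flat `{x : x₀ = x₁ = x₂ = x₃ = 0}` of `𝔽₂¹⁰` -/
def Eflat : Finset (Fin (5 + 5) → Bool) :=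
  Finset.univ.filter fun x => x 0 = false ∧ x 1 = false ∧ x 2 = false ∧ x 3 = false

/-- the zero vector of length 10 -/
def z10 : Fin (5 + 5) → Bool := fun _ => false

/-- `Eflat` is closed under xor -/
theorem Eflat_xor : ∀ a ∈ Eflat, ∀ b ∈ Eflat, bxor a b ∈ Eflat := by
  intro a ha b hb
  simp only [Eflat, Finset.mem_filter, Finset.mem_univ, true_and] at ha hb ⊢
  simp [ha, hb]

/-- `Eflat` has `64 = 2^{10-4}` elements -/
theorem Eflat_card : Eflat.card = 2 ^ (5 + 5 - 4) := by
  rw [Eflat, card_filter_E]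
  native_decide

/-- `g4` has weight 22 on `Eflat` -/
theorem Eflat_weight : (Eflat.filter fun x => g4 (bxor z10 x) = true).card = 22 := by
  rw [Eflat, Finset.filter_filter, card_filter_E]
  native_decide

/-- Any proof of `stub_two_adic_flats` must use that the dual `f` is cubic: for PP20's `h^10_4 = g4` (quartic dual `f4`)
the coordinate 6-flat `{x₀ = x₁ = x₂ = x₃ = 0}` has weight 22, not a multiple of `4 = 2^{5-3}`. -/
theorem twoAdicFlats_false_without_fCubic : ¬ TwoAdicFlatsWithoutFCubic := by
  intro h
  have h22 := h 5 f4 g4 W_g4 Eflat Eflat_xor Eflat_card z10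
  rw [Eflat_weight] at h22
  revert h22
  decide

/-! ### Mutation of `stub_dillon_normal_form`: bentness cannot be dropped -/

/-- `stub_dillon_normal_form` with the bentness/duality hypothesis DROPPED: "a function affine on every coset of an
`m`-dimensional subspace is in the completed MM class". -/
def DillonNormalFormWithoutBent : Prop :=
  ∀ (m : ℕ) (g : (Fin (m + m) → Bool) → Bool),
    (∃ V : Finset (Fin (m + m) → Bool), (∀ a ∈ V, ∀ b ∈ V, bxor a b ∈ V) ∧ V.card = 2 ^ m ∧
      ∀ a ∈ V, ∀ b ∈ V, ∀ x : Fin (m + m) → Bool,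
        (g x ^^ g (bxor x a) ^^ g (bxor x b) ^^ g (bxor (bxor x a) b)) = false) →
    MMConclusionAt m g

/-- The zero function on `1 + 1` bits is not in the completed MM class: the normal form forces `perm` constant. -/
theorem zero_not_MM : ¬ MMConclusionAt 1 (fun _ => false) := by
  rintro ⟨e, -, perm, h, H⟩
  have key : ∀ y'' : Fin 1 → Bool, perm y'' 0 = false := by
    intro y''
    have h0 := H (fun _ => false) y''
    have h1 := H (fun _ => true) y''
    simp only [Fin.sum_univ_one] at h0 h1
    revert h0 h1
    cases h y'' <;> cases perm y'' 0 <;> simp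
  have hc : perm (fun _ => false) = perm (fun _ => true) := by
    funext i
    fin_cases i
    simp [key]
  have := congrFun (perm.injective hc) 0
  simp at this

/-- the 2-element subgroup `{x : x₁ = 0}` of `𝔽₂²` -/
def V2 : Finset (Fin (1 + 1) → Bool) := Finset.univ.filter fun x => x 1 = false

/-- Any proof of `stub_dillon_normal_form` must use bentness (`W_g = ±2^m`): the zero function on `𝔽₂²` is affine on the
cosets of the 1-dimensional `V2` but is not in the completed MM class (`perm` would have to be constant). -/
theorem dillonNormalForm_false_without_bent : ¬ DillonNormalFormWithoutBent := by
  intro h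
  refine zero_not_MM (h 1 (fun _ => false) ⟨V2, ?_, by decide, ?_⟩)
  · intro a ha b hb
    simp only [V2, Finset.mem_filter, Finset.mem_univ, true_and] at ha hb ⊢
    simp [ha, hb]
  · intro a _ b _ x
    simp

end Summit.QuantumAdvantage.QuantumAdvantage.Theorems.ExactPairsMaioranaMcFarland.Negative.TwoAdicMutations
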